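import Mathlib
import Summits.MatrixMultiplication.MatrixMultiplication.Theorems.GradedDesignFamily.Negative.SubfieldCellUnipotent

/-!
# The BOREL ENDGAME (E2) of THEOREM F′ for S3, proved
# (crux `LevelGradedCohnUmans.GradedDesignFamily`, stmt-MatrixMultiplication-7610; negative side,
# line `quadratic-extension-level-one-cell`, unit b2b-lgcu-subfield gen 18)

HONEST FRAMING.  This discharges hypothesis (E2) of `footprintExpansion_of_structure`
(`Negative/SubfieldCellExpansion.lean`): for an injective hom `φ : SL₂(k) →* GL₂(K)`, `|K| = |k|²`,
the image `φ(SL₂ k)` is NOT contained in `X · Stab(ℓ) · g` for a line `ℓ = Kv` and `|X| ≤ M`, once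
`|K| > (M+1)²`.  Elementary proof by unipotents (no subgroup classification): with `w = g⁻¹v`, every
`φ(a)w` lies on one of the `≤ M` lines `K·xv` (`x ∈ X`); if the unipotent `φ(u_1)` (or `φ(l_1)`) moves
`w`, the `q = |k|` vectors `φ(u_y)w` lie on pairwise distinct lines (`unipotentFamily_card_le`: a
unipotent with an eigenvector off its fixed line is trivial, `fin_two_commuting_sqZero_mulVec`), so
`q ≤ M`; if both fix `w` then all of `φ(SL₂ k)` fixes `w` (`sl2md_decomp`), so `(u_1 l_1)^p = 1`
(`subfieldCell_pow_char_of_fixed`), which the `2 × 2` computation `((u_1 l_1) − 1)² ≠ 0` refutes.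
The remaining hypotheses (T), (S) of the composition are untouched ((E1) is
`subfieldCell_slicedEndgame`).  A certificate on the NEGATIVE side of the design stub S3; NOT summit
progress.

Sorry-free. [folklore]
-/

set_option linter.dupNamespace false

open Matrix

namespace Summit.MatrixMultiplication.MatrixMultiplication.Theorems.GradedDesignFamily.Negative

section Lower

variable {k : Type} [Field k]

/-- `l_x l_y = l_{x+y}`. [folklore] -/
theorem sl2md_lower_mul (x y : k) :
    (⟨_, sl2md_det_lower x⟩ * ⟨_, sl2md_det_lower y⟩ : Matrix.SpecialLinearGroup (Fin 2) k) =
      ⟨_, sl2md_det_lower (x + y)⟩ := by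
  refine Matrix.SpecialLinearGroup.ext _ _ fun i j => ?_
  rw [Matrix.SpecialLinearGroup.coe_mul]
  fin_cases i <;> fin_cases j <;> simp [Matrix.mul_apply, Fin.sum_univ_two, add_comm]

end Lower

section Family

variable {k K : Type} [Field k] [Fintype k] [DecidableEq k] [Field K]

/-- **Unipotent orbit count.**  Let `n : k → GL₂(K)` be an injective additive-to-multiplicative
family of unipotents (`(n_y − 1)² = 0`) and `w ≠ 0` a vector MOVED by `n_1`.  If every `n_y w` lies
on one of the lines `K · x v`, `x ∈ X`, then `|k| ≤ |X|`: the lines `K · n_y w` are pairwise distinct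
(an `n_d`, `d ≠ 0`, with an eigenvector forces `n_1` to fix it, by `fin_two_commuting_sqZero_mulVec`).
[folklore] -/
theorem unipotentFamily_card_le
    (n : k → Matrix.GeneralLinearGroup (Fin 2) K) (hadd : ∀ x y, n (x + y) = n x * n y)
    (hinj : Function.Injective n)
    (hsq : ∀ y, (((n y : Matrix.GeneralLinearGroup (Fin 2) K) : Matrix (Fin 2) (Fin 2) K) - 1) *
      (((n y : Matrix.GeneralLinearGroup (Fin 2) K) : Matrix (Fin 2) (Fin 2) K) - 1) = 0)
    (w : Fin 2 → K) (hw : w ≠ 0)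
    (hN1 : (((n 1 : Matrix.GeneralLinearGroup (Fin 2) K) : Matrix (Fin 2) (Fin 2) K) - 1) *ᵥ w ≠ 0)
    (X : Finset (Matrix.GeneralLinearGroup (Fin 2) K)) (v : Fin 2 → K)
    (hcover : ∀ y, ∃ x ∈ X, ∃ t : K,
      ((n y : Matrix.GeneralLinearGroup (Fin 2) K) : Matrix (Fin 2) (Fin 2) K) *ᵥ w =
        t • (((x : Matrix.GeneralLinearGroup (Fin 2) K) : Matrix (Fin 2) (Fin 2) K) *ᵥ v)) :
    Fintype.card k ≤ X.card := by
  classical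
  choose xs hxs ts hts using hcover
  have hcomm : ∀ x y, n x * n y = n y * n x := fun x y => by rw [← hadd, add_comm, hadd]
  have hn0 : n 0 = 1 := by
    have h := hadd 0 0
    rw [add_zero] at h
    have h' : n 0 * n 0 = n 0 * 1 := by rw [mul_one]; exact h.symm
    exact mul_left_cancel h'
  -- `n_y` is invertible on vectors
  have hcancel : ∀ y (u u' : Fin 2 → K),
      ((n y : Matrix.GeneralLinearGroup (Fin 2) K) : Matrix (Fin 2) (Fin 2) K) *ᵥ u =
        ((n y : Matrix.GeneralLinearGroup (Fin 2) K) : Matrix (Fin 2) (Fin 2) K) *ᵥ u' → u = u' := by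
    intro y u u' h
    have h2 := congrArg (fun z => (((n y)⁻¹ : Matrix.GeneralLinearGroup (Fin 2) K) :
      Matrix (Fin 2) (Fin 2) K) *ᵥ z) h
    simpa only [Matrix.mulVec_mulVec, Units.inv_mul, Matrix.one_mulVec] using h2
  have hne0 : ∀ y (u : Fin 2 → K), u ≠ 0 →
      ((n y : Matrix.GeneralLinearGroup (Fin 2) K) : Matrix (Fin 2) (Fin 2) K) *ᵥ u ≠ 0 := by
    intro y u hu h
    apply hu
    apply hcancel y
    rw [h, Matrix.mulVec_zero]
  -- the map `y ↦ x_y ∈ X` is injective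
  have hinjOn : Set.InjOn xs (Finset.univ : Finset k) := by
    intro y _ y' _ hxy
    by_contra hne
    have hd : y - y' ≠ 0 := sub_ne_zero.2 hne
    -- `w' = n_{y'} w ≠ 0` is an eigenvector of `n_d`, `d = y - y'`
    have hw' := hne0 y' w hw
    have hty' : ts y' ≠ 0 := by
      intro h0
      apply hw'
      rw [hts y', h0, zero_smul]
    have hdec : n y = n (y - y') * n y' := by rw [← hadd, sub_add_cancel]
    have heig : ((n (y - y') : Matrix.GeneralLinearGroup (Fin 2) K) : Matrix (Fin 2) (Fin 2) K) *ᵥ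
        (((n y' : Matrix.GeneralLinearGroup (Fin 2) K) : Matrix (Fin 2) (Fin 2) K) *ᵥ w) =
        (ts y * (ts y')⁻¹) • (((n y' : Matrix.GeneralLinearGroup (Fin 2) K) :
          Matrix (Fin 2) (Fin 2) K) *ᵥ w) := by
      rw [Matrix.mulVec_mulVec, ← Units.val_mul, ← hdec, hts y, hts y', smul_smul, mul_assoc,
        inv_mul_cancel₀ hty', mul_one, hxy]
    -- a unipotent's eigenvalue is `1`
    have hN : ((((n (y - y') : Matrix.GeneralLinearGroup (Fin 2) K) : Matrix (Fin 2) (Fin 2) K) - 1) *ᵥ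
        (((n y' : Matrix.GeneralLinearGroup (Fin 2) K) : Matrix (Fin 2) (Fin 2) K) *ᵥ w)) =
        (ts y * (ts y')⁻¹ - 1) • (((n y' : Matrix.GeneralLinearGroup (Fin 2) K) :
          Matrix (Fin 2) (Fin 2) K) *ᵥ w) := by
      rw [Matrix.sub_mulVec, Matrix.one_mulVec, heig, sub_smul, one_smul]
    have hr : ts y * (ts y')⁻¹ - 1 = 0 := by
      have h2 : ((ts y * (ts y')⁻¹ - 1) * (ts y * (ts y')⁻¹ - 1)) •
          (((n y' : Matrix.GeneralLinearGroup (Fin 2) K) : Matrix (Fin 2) (Fin 2) K) *ᵥ w) = 0 := by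
        rw [mul_smul, ← hN, ← Matrix.mulVec_smul, ← hN, Matrix.mulVec_mulVec, hsq,
          Matrix.zero_mulVec]
      have h3 : (ts y * (ts y')⁻¹ - 1) * (ts y * (ts y')⁻¹ - 1) = 0 :=
        (smul_eq_zero.1 h2).resolve_right hw'
      exact mul_self_eq_zero.1 h3
    rw [hr, zero_smul] at hN
    -- hence `n_1` fixes `w' = n_{y'} w`, i.e. fixes `w`: contradiction
    have hNd : (((n (y - y') : Matrix.GeneralLinearGroup (Fin 2) K) : Matrix (Fin 2) (Fin 2) K) - 1) ≠ 0 := by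
      intro h0
      have h1 : n (y - y') = 1 := Units.val_eq_one.1 (sub_eq_zero.1 h0)
      exact hd (hinj (h1.trans hn0.symm))
    have hc : (((n (y - y') : Matrix.GeneralLinearGroup (Fin 2) K) : Matrix (Fin 2) (Fin 2) K) - 1) *
        (((n 1 : Matrix.GeneralLinearGroup (Fin 2) K) : Matrix (Fin 2) (Fin 2) K) - 1) =
        (((n 1 : Matrix.GeneralLinearGroup (Fin 2) K) : Matrix (Fin 2) (Fin 2) K) - 1) *
        (((n (y - y') : Matrix.GeneralLinearGroup (Fin 2) K) : Matrix (Fin 2) (Fin 2) K) - 1) := by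
      have hm : ((n (y - y') : Matrix.GeneralLinearGroup (Fin 2) K) : Matrix (Fin 2) (Fin 2) K) *
          ((n 1 : Matrix.GeneralLinearGroup (Fin 2) K) : Matrix (Fin 2) (Fin 2) K) =
          ((n 1 : Matrix.GeneralLinearGroup (Fin 2) K) : Matrix (Fin 2) (Fin 2) K) *
          ((n (y - y') : Matrix.GeneralLinearGroup (Fin 2) K) : Matrix (Fin 2) (Fin 2) K) := by
        rw [← Units.val_mul, ← Units.val_mul, hcomm]
      simp only [sub_mul, mul_sub, mul_one, one_mul, hm]
      abel
    have hfix := fin_two_commuting_sqZero_mulVec _ _ hNd (hsq 1) hc _ hw' hN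
    rw [Matrix.sub_mulVec, Matrix.one_mulVec, sub_eq_zero, Matrix.mulVec_mulVec, ← Units.val_mul,
      hcomm, Units.val_mul, ← Matrix.mulVec_mulVec] at hfix
    have hfix' := hcancel y' _ _ hfix
    apply hN1
    rw [Matrix.sub_mulVec, Matrix.one_mulVec, hfix', sub_self]
  have := Finset.card_le_card_of_injOn xs (fun y _ => hxs y) hinjOn
  simpa using this

end Family

/-- **(E2) BOREL ENDGAME, proved.**  The statement is hypothesis (E2) of
`footprintExpansion_of_structure`, verbatim.  NOT summit progress. [folklore] -/
theorem subfieldCell_borelEndgame :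
    ∀ M : ℕ, ∃ Q₄ : ℕ, ∀ (k K : Type) [Field k] [Fintype k] [DecidableEq k]
      [Field K] [Fintype K] [DecidableEq K]
      (φ : Matrix.SpecialLinearGroup (Fin 2) k →* Matrix.GeneralLinearGroup (Fin 2) K),
      Function.Injective φ → Fintype.card K = Fintype.card k ^ 2 → Q₄ ≤ Fintype.card K →
      ∀ v : Fin 2 → K, v ≠ 0 → ∀ X : Finset (Matrix.GeneralLinearGroup (Fin 2) K), X.card ≤ M →
        ∀ g : Matrix.GeneralLinearGroup (Fin 2) K,
          (∀ a : Matrix.SpecialLinearGroup (Fin 2) k, ∃ x ∈ X, ∃ s : Matrix.GeneralLinearGroup (Fin 2) K,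
            (∃ t : K, (s : Matrix (Fin 2) (Fin 2) K).mulVec v = t • v) ∧ φ a = x * s * g) → False := by
  intro M
  refine ⟨(M + 1) ^ 2 + 1, ?_⟩
  intro k K _ _ _ _ _ _ φ hφ hK hQ v hv X hXM g hcov
  -- `M + 1 ≤ q`
  have hq : M + 1 ≤ Fintype.card k := by
    by_contra hlt
    push Not at hlt
    have : Fintype.card k ^ 2 ≤ M ^ 2 := Nat.pow_le_pow_left (by omega) 2
    have : (M + 1) ^ 2 + 1 ≤ M ^ 2 := hQ.trans (hK ▸ this)
    nlinarith
  -- `w = g⁻¹ v ≠ 0`, and every `φ(a) w` lies on a line `K · x v`, `x ∈ X`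
  have hw : ((g⁻¹ : Matrix.GeneralLinearGroup (Fin 2) K) : Matrix (Fin 2) (Fin 2) K) *ᵥ v ≠ 0 := by
    intro h
    apply hv
    have h2 := congrArg (fun z => ((g : Matrix.GeneralLinearGroup (Fin 2) K) :
      Matrix (Fin 2) (Fin 2) K) *ᵥ z) h
    simpa only [Matrix.mulVec_mulVec, Units.mul_inv, Matrix.one_mulVec, Matrix.mulVec_zero] using h2
  have hcovw : ∀ a : Matrix.SpecialLinearGroup (Fin 2) k, ∃ x ∈ X, ∃ t : K,
      ((φ a : Matrix.GeneralLinearGroup (Fin 2) K) : Matrix (Fin 2) (Fin 2) K) *ᵥ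
        (((g⁻¹ : Matrix.GeneralLinearGroup (Fin 2) K) : Matrix (Fin 2) (Fin 2) K) *ᵥ v) =
        t • (((x : Matrix.GeneralLinearGroup (Fin 2) K) : Matrix (Fin 2) (Fin 2) K) *ᵥ v) := by
    intro a
    obtain ⟨x, hx, s, ⟨t, hst⟩, hax⟩ := hcov a
    refine ⟨x, hx, t, ?_⟩
    rw [hax, Matrix.mulVec_mulVec, Units.val_mul, mul_assoc, Units.mul_inv, mul_one, Units.val_mul,
      ← Matrix.mulVec_mulVec]
    change ((x : Matrix.GeneralLinearGroup (Fin 2) K) : Matrix (Fin 2) (Fin 2) K) *ᵥ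
      ((s : Matrix (Fin 2) (Fin 2) K) *ᵥ v) = _
    rw [hst, Matrix.mulVec_smul]
  -- the two unipotent families
  haveI hprime : Fact (ringChar k).Prime := ⟨CharP.char_is_prime k _⟩
  let nU : k → Matrix.GeneralLinearGroup (Fin 2) K := fun y => φ ⟨_, sl2md_det_upper y⟩
  let nL : k → Matrix.GeneralLinearGroup (Fin 2) K := fun y => φ ⟨_, sl2md_det_lower y⟩
  have hUadd : ∀ x y, nU (x + y) = nU x * nU y := fun x y => by
    simp only [nU, ← map_mul, sl2md_upper_mul]
  have hLadd : ∀ x y, nL (x + y) = nL x * nL y := fun x y => by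
    simp only [nL, ← map_mul, sl2md_lower_mul]
  have hUinj : Function.Injective nU := by
    intro x y h
    have h1 := hφ h
    have h2 := congrArg (fun s : Matrix.SpecialLinearGroup (Fin 2) k => (s : Matrix (Fin 2) (Fin 2) k) 0 1) h1
    simpa using h2
  have hLinj : Function.Injective nL := by
    intro x y h
    have h1 := hφ h
    have h2 := congrArg (fun s : Matrix.SpecialLinearGroup (Fin 2) k => (s : Matrix (Fin 2) (Fin 2) k) 1 0) h1
    simpa using h2
  have hUsq : ∀ y, (((nU y : Matrix.GeneralLinearGroup (Fin 2) K) : Matrix (Fin 2) (Fin 2) K) - 1) *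
      (((nU y : Matrix.GeneralLinearGroup (Fin 2) K) : Matrix (Fin 2) (Fin 2) K) - 1) = 0 :=
    fun y => subfieldCell_sub_one_sq_of_pow_char φ hK _ (subfieldCell_upper_pow_char y)
  -- `l_x^m = l_{m x}`, `l_x^p = 1` (the lower-unitriangular twins of `subfieldCell_upper_pow(_char)`)
  have hLpow : ∀ (x : k) (m : ℕ), (⟨_, sl2md_det_lower x⟩ ^ m : Matrix.SpecialLinearGroup (Fin 2) k) =
      ⟨_, sl2md_det_lower ((m : k) * x)⟩ := by
    intro x m
    induction m with
    | zero => rw [pow_zero, Nat.cast_zero, zero_mul]; exact sl2md_lower_zero.symm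
    | succ m ih => rw [pow_succ, ih, sl2md_lower_mul, Nat.cast_succ, add_mul, one_mul]
  have hLchar : ∀ x : k, (⟨_, sl2md_det_lower x⟩ ^ ringChar k : Matrix.SpecialLinearGroup (Fin 2) k) = 1 :=
    fun x => by rw [hLpow, ringChar.Nat.cast_ringChar, zero_mul]; exact sl2md_lower_zero
  have hLsq : ∀ y, (((nL y : Matrix.GeneralLinearGroup (Fin 2) K) : Matrix (Fin 2) (Fin 2) K) - 1) *
      (((nL y : Matrix.GeneralLinearGroup (Fin 2) K) : Matrix (Fin 2) (Fin 2) K) - 1) = 0 :=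
    fun y => subfieldCell_sub_one_sq_of_pow_char φ hK _ (hLchar y)
  have hUcov := fun y => hcovw ⟨_, sl2md_det_upper y⟩
  have hLcov := fun y => hcovw ⟨_, sl2md_det_lower y⟩
  by_cases hU : (((nU 1 : Matrix.GeneralLinearGroup (Fin 2) K) : Matrix (Fin 2) (Fin 2) K) - 1) *ᵥ
      (((g⁻¹ : Matrix.GeneralLinearGroup (Fin 2) K) : Matrix (Fin 2) (Fin 2) K) *ᵥ v) = 0
  swap
  · have h := unipotentFamily_card_le nU hUadd hUinj hUsq _ hw hU X v hUcov
    omega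
  by_cases hL : (((nL 1 : Matrix.GeneralLinearGroup (Fin 2) K) : Matrix (Fin 2) (Fin 2) K) - 1) *ᵥ
      (((g⁻¹ : Matrix.GeneralLinearGroup (Fin 2) K) : Matrix (Fin 2) (Fin 2) K) *ᵥ v) = 0
  swap
  · have h := unipotentFamily_card_le nL hLadd hLinj hLsq _ hw hL X v hLcov
    omega
  -- both `φ(u_1)` and `φ(l_1)` fix `w`: then every `φ(u_y)`, `φ(l_y)` does, hence all of `φ(SL₂ k)`
  have hfixAll : ∀ (n : k → Matrix.GeneralLinearGroup (Fin 2) K), (∀ x y, n (x + y) = n x * n y) →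
      Function.Injective n →
      (∀ y, (((n y : Matrix.GeneralLinearGroup (Fin 2) K) : Matrix (Fin 2) (Fin 2) K) - 1) *
        (((n y : Matrix.GeneralLinearGroup (Fin 2) K) : Matrix (Fin 2) (Fin 2) K) - 1) = 0) →
      (((n 1 : Matrix.GeneralLinearGroup (Fin 2) K) : Matrix (Fin 2) (Fin 2) K) - 1) *ᵥ
        (((g⁻¹ : Matrix.GeneralLinearGroup (Fin 2) K) : Matrix (Fin 2) (Fin 2) K) *ᵥ v) = 0 →
      ∀ y, ((n y : Matrix.GeneralLinearGroup (Fin 2) K) : Matrix (Fin 2) (Fin 2) K) *ᵥ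
        (((g⁻¹ : Matrix.GeneralLinearGroup (Fin 2) K) : Matrix (Fin 2) (Fin 2) K) *ᵥ v) =
        ((g⁻¹ : Matrix.GeneralLinearGroup (Fin 2) K) : Matrix (Fin 2) (Fin 2) K) *ᵥ v := by
    intro n hadd hinj hsq h1 y
    have hn0 : n 0 = 1 := by
      have h := hadd 0 0
      rw [add_zero] at h
      have h' : n 0 * n 0 = n 0 * 1 := by rw [mul_one]; exact h.symm
      exact mul_left_cancel h'
    have hN1 : (((n 1 : Matrix.GeneralLinearGroup (Fin 2) K) : Matrix (Fin 2) (Fin 2) K) - 1) ≠ 0 := by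
      intro h0
      have h1' : n 1 = 1 := Units.val_eq_one.1 (sub_eq_zero.1 h0)
      exact one_ne_zero (hinj (h1'.trans hn0.symm))
    have hcomm : n 1 * n y = n y * n 1 := by rw [← hadd, add_comm, hadd]
    have hc : (((n 1 : Matrix.GeneralLinearGroup (Fin 2) K) : Matrix (Fin 2) (Fin 2) K) - 1) *
        (((n y : Matrix.GeneralLinearGroup (Fin 2) K) : Matrix (Fin 2) (Fin 2) K) - 1) =
        (((n y : Matrix.GeneralLinearGroup (Fin 2) K) : Matrix (Fin 2) (Fin 2) K) - 1) *
        (((n 1 : Matrix.GeneralLinearGroup (Fin 2) K) : Matrix (Fin 2) (Fin 2) K) - 1) := by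
      have hm : ((n 1 : Matrix.GeneralLinearGroup (Fin 2) K) : Matrix (Fin 2) (Fin 2) K) *
          ((n y : Matrix.GeneralLinearGroup (Fin 2) K) : Matrix (Fin 2) (Fin 2) K) =
          ((n y : Matrix.GeneralLinearGroup (Fin 2) K) : Matrix (Fin 2) (Fin 2) K) *
          ((n 1 : Matrix.GeneralLinearGroup (Fin 2) K) : Matrix (Fin 2) (Fin 2) K) := by
        rw [← Units.val_mul, ← Units.val_mul, hcomm]
      simp only [sub_mul, mul_sub, mul_one, one_mul, hm]
      abel
    have h := fin_two_commuting_sqZero_mulVec _ _ hN1 (hsq y) hc _ hw h1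
    rwa [Matrix.sub_mulVec, Matrix.one_mulVec, sub_eq_zero] at h
  have hfU := hfixAll nU hUadd hUinj hUsq hU
  have hfL := hfixAll nL hLadd hLinj hLsq hL
  have hfix : ∀ a : Matrix.SpecialLinearGroup (Fin 2) k,
      ((φ a : Matrix.GeneralLinearGroup (Fin 2) K) : Matrix (Fin 2) (Fin 2) K) *ᵥ
        (((g⁻¹ : Matrix.GeneralLinearGroup (Fin 2) K) : Matrix (Fin 2) (Fin 2) K) *ᵥ v) =
        ((g⁻¹ : Matrix.GeneralLinearGroup (Fin 2) K) : Matrix (Fin 2) (Fin 2) K) *ᵥ v := by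
    intro a
    obtain ⟨a₁, b₁, c₁, d₁, rfl⟩ := sl2md_decomp a
    rw [map_mul, map_mul, map_mul, Units.val_mul, Units.val_mul, Units.val_mul,
      ← Matrix.mulVec_mulVec, ← Matrix.mulVec_mulVec, ← Matrix.mulVec_mulVec]
    have e1 := hfL d₁
    have e2 := hfU b₁
    have e3 := hfL c₁
    have e4 := hfU a₁
    simp only [nU, nL] at e1 e2 e3 e4
    rw [e1, e2, e3, e4]
  -- `a₀ = u_1 l_1` then has `a₀^p = 1`, contradicting `((a₀) − 1)² ≠ 0`
  have hp := subfieldCell_pow_char_of_fixed φ hφ hK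
    (⟨_, sl2md_det_upper (1 : k)⟩ * ⟨_, sl2md_det_lower (1 : k)⟩) _ hw (hfix _)
  have hA : ((⟨_, sl2md_det_upper (1 : k)⟩ * ⟨_, sl2md_det_lower (1 : k)⟩ :
      Matrix.SpecialLinearGroup (Fin 2) k) : Matrix (Fin 2) (Fin 2) k) ^ ringChar k = 1 := by
    rw [← Matrix.SpecialLinearGroup.coe_pow, hp, Matrix.SpecialLinearGroup.coe_one]
  have hN : (((⟨_, sl2md_det_upper (1 : k)⟩ * ⟨_, sl2md_det_lower (1 : k)⟩ :
      Matrix.SpecialLinearGroup (Fin 2) k) : Matrix (Fin 2) (Fin 2) k) - 1) ^ ringChar k = 0 := by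
    rw [sub_pow_char_of_commute (ringChar k) (Commute.one_right _), hA, one_pow, sub_self]
  have hN2 := fin_two_sq_eq_zero_of_pow_eq_zero _ _ hN
  have h01 := congr_fun (congr_fun hN2 0) 1
  rw [Matrix.SpecialLinearGroup.coe_mul] at h01
  norm_num [Matrix.mul_apply, Fin.sum_univ_two, Matrix.sub_apply, Matrix.one_apply] at h01

end Summit.MatrixMultiplication.MatrixMultiplication.Theorems.GradedDesignFamily.Negative
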